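import Literature.Analysis.FluidPDE.NSSuitableESSEpsilonProofs
import Literature.Analysis.FluidPDE.CKNLocalRegularityRRSPressure
import Literature.Analysis.FluidPDE.NSVorticityBoundedTop
import Literature.Analysis.FluidPDE.NSBoundedTimeHolderTop
import HarnessLib

/-!
# ESS Lemma 2.2 (`k = 1`), proved: `ess_epsilon_regularity'_holds`, `ess_epsilon_regularity_holds`

Analysis/FluidPDE proofs file (theorems only; no definitions, no named facts) **discharging the
named facts `Literature.Analysis.FluidPDE.ess_epsilon_regularity'` and
`Literature.Analysis.FluidPDE.ess_epsilon_regularity`** of `NSSuitableESS.lean` (L. Escauriaza,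
G. Seregin, V. Šverák, *`L_{3,∞}`-solutions of Navier–Stokes equations and backward uniqueness*,
Russ. Math. Surveys 58 (2003), Lemma 2.2, case `k = 1`, with Remark 2.3: "proved essentially in"
Caffarelli–Kohn–Nirenberg 1982, Cor. 1 = G. Seregin, *Lecture Notes on Regularity Theory for the
Navier–Stokes Equations* (2014), Lemma 6.1 (`k = 1`) with Remark 6.1): there are absolute
`ε₀, c₀₁ > 0` such that every suitable weak solution `(U, P)` in `Q = B × ]-1, 0[` with
`∫_Q (|U|³ + |P|^{3/2}) < ε₀` is Hölder continuous on the *closed* cylinder `Q̄(1/2)` with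
`max |U| < c₀₁`.

## The proof (Remark 2.3 / Remark 6.1: CKN's Proposition 1, then regularity of bounded solutions)

1. *Boundedness* (Caffarelli–Kohn–Nirenberg 1982, Prop. 1, in Robinson–Rodrigo–Sadowski's form,
   Thm. 15.3, **proved** in the tree: `RRS2016.theorem15_3_holds`, consumed through the accepted
   one-scale shape `unforced_epsilonRegularity_of_theorem15_3` and the accepted front end of
   `ess_epsilon_regularity'_of_oneScale_of_linear`): for `ε₀` small, `|U| ≤ 1` a.e. on `Q(3/4)`.
2. *Hölder continuity of bounded solutions up to the top* (Serrin 1962; RRS 2016, Thm. 13.7 and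
   §13.5), on the centred cylinder `Q*_{R₁}(z₁) = ]-2R₁², 0[ × B(R₁) ⊆ Q(3/4)`, `R₁ = 0.53`, whose
   top is the top `t = 0` of `Q`: bounded spin and `(C, α)`-Hölder slices for a.e.
   `t ∈ ]-R₁² - r₂², 0[` on `B(r₂)`, `r₂ = 0.52` (`SerrinTop.holder_slices_top`, this unit's
   `NSVorticityBoundedTop.lean`, resting on the improvement up to the top
   `HeatDivForm.heatDivForm_improvement_top`); then, on `Q*_{r₂}(z₃)`, `z₃ = (-r₂², 0)`, the
   quantitative slice-time argument (`SliceTimeHolder.exists_holderOnWith_representative`,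
   this unit's `NSBoundedTimeHolderTop.lean`) gives a representative Hölder for the product
   metric on `]-2r₂², 0[ × B(0.51) ⊇ Q(1/2)` (`exists_holder_representative_of_bounded`).
3. *The closed cylinder* (as in the accepted `ess_epsilon_regularity'_of_oneScale_of_linear`):
   `|V| ≤ 1` at every point of `Q(1/2)` by continuity, the Hölder extension of `V` to the closure
   (`holderOnWith_extendFrom_closure`) is the asserted representative, bounded by `1 < 2 = c₀₁`.

`ess_epsilon_regularity_holds` is then the accepted reduction `ess_epsilon_regularity_of'`
(`NSSuitableESSProofs.lean`: the mis-parenthesised class is contained in the corrected one on the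
unit ball). Trust base: Mathlib's axioms only.

## References

* L. Escauriaza, G. Seregin, V. Šverák, Russ. Math. Surveys 58:2 (2003) 211–250, Def. 2.1,
  Lemma 2.2, Remark 2.3. [`EscauriazaSereginSverak2003`]
* G. Seregin, *Lecture Notes on Regularity Theory for the Navier–Stokes Equations*, World
  Scientific 2014, Ch. 6, §6.1, Lemma 6.1 and Remark 6.1 (p. 90). [`Seregin2014`]
* L. Caffarelli, R. Kohn, L. Nirenberg, Comm. Pure Appl. Math. 35 (1982), Prop. 1, Cor. 1.
  [`CaffarelliKohnNirenberg1982`]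
* J. C. Robinson, J. L. Rodrigo, W. Sadowski, *The Three-Dimensional Navier–Stokes Equations*,
  CUP 2016, Thm. 13.7, §13.5, Thm. 15.3. [`RobinsonRodrigoSadowski2016`]
* J. Serrin, Arch. Rational Mech. Anal. 9 (1962) 187–195. [`Serrin1962`]
-/

noncomputable section

open MeasureTheory TopologicalSpace Set Function Filter Topology Metric
open scoped InnerProductSpace RealInnerProductSpace ENNReal NNReal Laplacian

namespace Literature.Analysis.FluidPDE

/-! ### Bounded solutions on `Q(3/4)` are Hölder on `Q(1/2)`, up to the top -/

/-- **Bounded suitable solutions have a Hölder representative on `Q(1/2)`, up to the top time**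
(Serrin 1962; Robinson–Rodrigo–Sadowski 2016, Thm. 13.7 with §13.5, through this unit's
`SerrinTop.holder_slices_top` and `SliceTimeHolder.exists_holderOnWith_representative`). Let
`(U, P)` solve the Navier–Stokes system (`ν = 1`, no force) in the sense of distributions in
`Q = Q(1)`, with a weak spatial gradient `G`, `∫∫_Q |G|² < ∞`, `P ∈ L_{3/2}(Q)`, and `|U| ≤ 1`
a.e. on `Q(3/4)`. Then `U` agrees a.e. on `Q(1/2)` with a function which is Hölder continuous on
`Q(1/2)` for the product metric (some exponent `α > 0`, some constant). Geometry: the centred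
cylinder `Q*_{R₁}(z₁)`, `z₁ = (-R₁², 0)`, `R₁ = 53/100`, lies in `Q(3/4)` and has top `0`; Hölder
slices on `B(13/25)` for a.e. `t ∈ ]-R₁² - (13/25)², 0[`; the slice-time argument on
`Q*_{13/25}((- (13/25)², 0))` gives the representative on `]-2 (13/25)², 0[ × B(51/100) ⊇ Q(1/2)`.
[cite: RobinsonRodrigoSadowskiCUP2016, Thm. 13.7 and §13.5; EscauriazaSereginSverak2003, Lemma 2.2 (k = 1), Remark 2.3] -/
theorem exists_holder_representative_of_bounded
    (U : ℝ → EuclideanSpace ℝ (Fin 3) → EuclideanSpace ℝ (Fin 3))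
    (P : ℝ → EuclideanSpace ℝ (Fin 3) → ℝ)
    (G : ℝ → EuclideanSpace ℝ (Fin 3) → EuclideanSpace ℝ (Fin 3) →L[ℝ] EuclideanSpace ℝ (Fin 3))
    (hNS : IsDistributionalNSSolutionOn
      (parabolicCylinderOpens 1 (0 : ℝ × EuclideanSpace ℝ (Fin 3))) 1 0 U P)
    (hG : HasWeakSpatialGradientOn
      (parabolicCylinderOpens 1 (0 : ℝ × EuclideanSpace ℝ (Fin 3))) U G)
    (hG2 : ∫⁻ w in parabolicCylinder 1 (0 : ℝ × EuclideanSpace ℝ (Fin 3)),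
      ENNReal.ofReal (frobeniusNormSq (G w.1 w.2)) < ∞)
    (hP : ∫⁻ w in parabolicCylinder 1 (0 : ℝ × EuclideanSpace ℝ (Fin 3)),
      ‖P w.1 w.2‖ₑ ^ (3 / 2 : ℝ) < ∞)
    (hbd : ∀ᵐ w ∂(volume.restrict (parabolicCylinder (3 / 4) (0 : ℝ × EuclideanSpace ℝ (Fin 3)))),
      ‖U w.1 w.2‖ ≤ 1) :
    ∃ (V : ℝ × EuclideanSpace ℝ (Fin 3) → EuclideanSpace ℝ (Fin 3)) (K α : ℝ≥0), 0 < α ∧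
      V =ᵐ[volume.restrict (parabolicCylinder (1 / 2) (0 : ℝ × EuclideanSpace ℝ (Fin 3)))]
        uncurry U ∧
      HolderOnWith K α V (parabolicCylinder (1 / 2) (0 : ℝ × EuclideanSpace ℝ (Fin 3))) := by
  -- the radii and centres
  set R₁ : ℝ := 53 / 100 with hR₁
  set r₂ : ℝ := 13 / 25 with hr₂
  set r₄ : ℝ := 51 / 100 with hr₄
  set z₁ : ℝ × EuclideanSpace ℝ (Fin 3) := (-(R₁ ^ 2), 0) with hz₁
  set z₃ : ℝ × EuclideanSpace ℝ (Fin 3) := (-(r₂ ^ 2), 0) with hz₃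
  have hz₁1 : z₁.1 = -(R₁ ^ 2) := rfl
  have hz₁2 : z₁.2 = 0 := rfl
  have hz₃1 : z₃.1 = -(r₂ ^ 2) := rfl
  have hz₃2 : z₃.2 = 0 := rfl
  -- the inclusions
  have h34 : parabolicCylinder (3 / 4) (0 : ℝ × EuclideanSpace ℝ (Fin 3)) ⊆
      parabolicCylinder 1 (0 : ℝ × EuclideanSpace ℝ (Fin 3)) :=
    parabolicCylinder_zero_mono (by norm_num) (by norm_num)
  have h1 : parabolicCylinderCentered R₁ z₁ ⊆
      parabolicCylinder (3 / 4) (0 : ℝ × EuclideanSpace ℝ (Fin 3)) := by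
    intro w hw
    rw [mem_parabolicCylinderCentered, hz₁1, hz₁2] at hw
    rw [mem_parabolicCylinder]
    refine ⟨⟨?_, ?_⟩, ?_⟩
    · have := hw.1.1
      show (0 : ℝ × EuclideanSpace ℝ (Fin 3)).1 - (3 / 4) ^ 2 < w.1
      rw [Prod.fst_zero, hR₁] at *
      linarith
    · have := hw.1.2
      show w.1 < (0 : ℝ × EuclideanSpace ℝ (Fin 3)).1
      rw [Prod.fst_zero]
      linarith
    · show dist w.2 (0 : ℝ × EuclideanSpace ℝ (Fin 3)).2 < 3 / 4
      rw [Prod.snd_zero]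
      rw [hR₁] at hw
      linarith [hw.2]
  have h3 : parabolicCylinderCentered r₂ z₃ ⊆ parabolicCylinderCentered R₁ z₁ := by
    intro w hw
    rw [mem_parabolicCylinderCentered, hz₃1, hz₃2] at hw
    rw [mem_parabolicCylinderCentered, hz₁1, hz₁2]
    refine ⟨⟨?_, ?_⟩, ?_⟩
    · rw [hR₁]; rw [hr₂] at hw; linarith [hw.1.1]
    · rw [hR₁]; rw [hr₂] at hw; linarith [hw.1.2]
    · rw [hR₁]; rw [hr₂] at hw; linarith [hw.2]
  have hwin : Ioo (z₃.1 - r₂ ^ 2) (z₃.1 + r₂ ^ 2) ⊆ Ioo (z₁.1 - r₂ ^ 2) (z₁.1 + R₁ ^ 2) := by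
    rw [hz₃1, hz₁1, hR₁, hr₂]
    exact Ioo_subset_Ioo (by norm_num) (by norm_num)
  have hQhalf : parabolicCylinder (1 / 2) (0 : ℝ × EuclideanSpace ℝ (Fin 3)) ⊆
      Ioo (z₃.1 - r₂ ^ 2) (z₃.1 + r₂ ^ 2) ×ˢ ball z₃.2 r₄ := by
    intro w hw
    rw [mem_parabolicCylinder] at hw
    rw [hz₃1, hz₃2, hr₂, hr₄]
    refine ⟨⟨?_, ?_⟩, ?_⟩
    · have := hw.1.1
      rw [Prod.fst_zero] at this
      linarith
    · have := hw.1.2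
      rw [Prod.fst_zero] at this
      linarith
    · rw [mem_ball]
      have := hw.2
      rw [Prod.snd_zero] at this
      linarith
  -- the data on `Q*_{R₁}(z₁)`
  have hle1 : parabolicCylinderCenteredOpens R₁ z₁ ≤
      parabolicCylinderOpens 1 (0 : ℝ × EuclideanSpace ℝ (Fin 3)) := fun w hw => h34 (h1 hw)
  have hsol₁ : IsDistributionalNSSolutionOn (parabolicCylinderCenteredOpens R₁ z₁) 1 0 U P :=
    hNS.of_le hle1
  have hbd₁ : ∀ᵐ w ∂(volume.restrict (parabolicCylinderCentered R₁ z₁)), ‖U w.1 w.2‖ ≤ 1 :=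
    ae_restrict_of_ae_restrict_of_subset h1 hbd
  have hG₁ : HasWeakSpatialGradientOn (parabolicCylinderCenteredOpens R₁ z₁) U G := hG.mono hle1
  have hG2₁ : ∫⁻ w in parabolicCylinderCentered R₁ z₁,
      ENNReal.ofReal (frobeniusNormSq (G w.1 w.2)) < ∞ :=
    lt_of_le_of_lt (lintegral_mono_set (h1.trans h34)) hG2
  -- Hölder slices up to the top, on `B(r₂)` for a.e. `t ∈ ]-R₁² - r₂², 0[`
  obtain ⟨C, α, hα, hslices⟩ := SerrinTop.holder_slices_top U P z₁ R₁ 1 G hsol₁ hbd₁ hG₁ hG2₁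
    (r := r₂) ⟨by norm_num, by norm_num⟩
  -- the data on `Q*_{r₂}(z₃)`
  have hle3 : parabolicCylinderCenteredOpens r₂ z₃ ≤ parabolicCylinderCenteredOpens R₁ z₁ :=
    fun w hw => h3 hw
  have hsol₃ : IsDistributionalNSSolutionOn (parabolicCylinderCenteredOpens r₂ z₃) 1 0 U P :=
    hsol₁.of_le hle3
  have hbd₃ : ∀ᵐ w ∂(volume.restrict (parabolicCylinderCentered r₂ z₃)), ‖U w.1 w.2‖ ≤ 1 :=
    ae_restrict_of_ae_restrict_of_subset h3 hbd₁
  have hP₃ : ∫⁻ w in parabolicCylinderCentered r₂ z₃, ‖P w.1 w.2‖ₑ ^ (3 / 2 : ℝ) < ∞ :=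
    lt_of_le_of_lt (lintegral_mono_set ((h3.trans h1).trans h34)) hP
  have hH₃ : ∀ᵐ t ∂(volume.restrict (Ioo (z₃.1 - r₂ ^ 2) (z₃.1 + r₂ ^ 2))),
      ∃ v : EuclideanSpace ℝ (Fin 3) → EuclideanSpace ℝ (Fin 3),
        HolderOnWith C α v (ball z₃.2 r₂) ∧ U t =ᵐ[volume.restrict (ball z₃.2 r₂)] v := by
    have h := ae_restrict_of_ae_restrict_of_subset hwin hslices
    rw [hz₃2]
    rw [hz₁2] at h
    exact h
  -- the Hölder representative for the product metric on `]-2r₂², 0[ × B(r₄)`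
  obtain ⟨W, K, κ, hκ, hWH, hWae⟩ :=
    SliceTimeHolder.exists_holderOnWith_representative U P z₃ r₂ 1 C α hα hsol₃ hbd₃ hP₃ hH₃
      (r := r₄) ⟨by norm_num, by norm_num⟩
  refine ⟨W, K, κ, hκ, ?_, hWH.mono hQhalf⟩
  have hae : uncurry U =ᵐ[volume.restrict (parabolicCylinder (1 / 2) (0 : ℝ × EuclideanSpace ℝ (Fin 3)))]
      W :=
    ae_restrict_of_ae_restrict_of_subset hQhalf hWae
  exact hae.symm

/-! ### The discharges -/

/-- **ESS Lemma 2.2 (`k = 1`), proved** — discharge of the named fact `ess_epsilon_regularity'`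
(Escauriaza–Seregin–Šverák 2003, Lemma 2.2 with Remark 2.3; Seregin 2014, Lemma 6.1, `k = 1`,
with Remark 6.1). Constants: `ε₀ = λ³/16`, `λ = min(ε_L, 1/(4C₀))` for the constants `ε_L, C₀` of
the proved one-scale criterion (`unforced_epsilonRegularity_of_theorem15_3 theorem15_3_holds`),
and `c₀₁ = 2`. The front end (boundedness `|U| ≤ 1` a.e. on `Q(3/4)`) is that of the accepted
`ess_epsilon_regularity'_of_oneScale_of_linear`; the Hölder representative on `Q(1/2)` up to the
top is `exists_holder_representative_of_bounded`; its values are bounded by `1` on the open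
cylinder by continuity, and its Hölder extension to the closure is the asserted representative,
bounded by `1 < 2`. [cite: EscauriazaSereginSverak2003, Lemma 2.2 (k = 1) with Remark 2.3] -/
theorem ess_epsilon_regularity'_holds : ess_epsilon_regularity' := by
  obtain ⟨εL, C₀, hεL, hC₀, H⟩ := unforced_epsilonRegularity_of_theorem15_3 RRS2016.theorem15_3_holds
  -- the smallness level: velocity bound `4 C₀ λ ≤ 1` on `Q(3/4)`
  set l : ℝ := min εL (1 / (4 * C₀)) with hl
  have hl0 : 0 < l := lt_min hεL (by positivity)
  have hlε : l ≤ εL := min_le_left _ _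
  have hM : C₀ * l / (1 / 4) ≤ 1 := by
    have h4 : l ≤ 1 / (4 * C₀) := min_le_right _ _
    rw [div_le_iff₀ (by norm_num : (0 : ℝ) < 1 / 4)]
    calc C₀ * l ≤ C₀ * (1 / (4 * C₀)) := by gcongr
      _ = 1 * (1 / 4) := by field_simp
  set ε₀ : ℝ := l ^ 3 * (1 / 4) ^ 2 with hε₀
  have hε₀pos : 0 < ε₀ := by positivity
  refine ⟨ε₀, 2, hε₀pos, two_pos, ?_⟩
  intro U P hU hsmall
  have hball : IsSuitableWeakSolutionInBall 1 (0 : ℝ × EuclideanSpace ℝ (Fin 3)) U P :=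
    hU.isSuitableWeakSolutionInBall_unit
  obtain ⟨G, hG, hG2⟩ := hball.2.2.1
  have hLR := hball.isLRSuitableWeakSolutionOn hG hG2 3
  -- `|U| ≤ 1` a.e. on `Q(3/4)`
  have hcentre : ∀ z₀ ∈ parabolicCylinder (3 / 4) (0 : ℝ × EuclideanSpace ℝ (Fin 3)),
      ∀ᵐ w ∂(volume.restrict (parabolicCylinder ((1 / 4) / 2) z₀)), ‖U w.1 w.2‖ ≤ 1 := by
    intro z₀ h₀
    have hsub : parabolicCylinder (1 / 4) z₀ ⊆
        parabolicCylinder 1 (0 : ℝ × EuclideanSpace ℝ (Fin 3)) :=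
      parabolicCylinder_quarter_subset_unit h₀
    have hsm : ∫⁻ w in parabolicCylinder (1 / 4) z₀,
        (‖U w.1 w.2‖ₑ ^ (3 : ℕ) + ‖P w.1 w.2‖ₑ ^ (3 / 2 : ℝ)) ≤
          ENNReal.ofReal (l ^ 3 * (1 / 4) ^ 2) :=
      (lintegral_mono_set hsub).trans hsmall.le
    have h1 := H _ 3 U P G (by norm_num) hLR z₀ (1 / 4) l (by norm_num) hsub hl0.le hlε hsm
    filter_upwards [h1] with w hw using hw.trans hM
  have hbd : ∀ᵐ w ∂(volume.restrict (parabolicCylinder (3 / 4) (0 : ℝ × EuclideanSpace ℝ (Fin 3)))),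
      ‖U w.1 w.2‖ ≤ 1 :=
    ae_parabolicCylinder_of_centres (P := fun w => ‖U w.1 w.2‖ ≤ 1) (by norm_num) hcentre
  -- the pressure bound on `Q(1)`
  have hP1 : ∫⁻ w in parabolicCylinder 1 (0 : ℝ × EuclideanSpace ℝ (Fin 3)),
      ‖P w.1 w.2‖ₑ ^ (3 / 2 : ℝ) < ∞ := by
    refine lt_of_le_of_lt (lintegral_mono fun w => ?_) (hsmall.trans ENNReal.ofReal_lt_top)
    exact le_add_self
  -- the Hölder representative on `Q(1/2)`, up to the top
  obtain ⟨V, K, α, hα, hVae, hVH⟩ :=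
    exists_holder_representative_of_bounded U P G hball.1.distributional hG hG2 hP1 hbd
  -- the representative on the closure of `Q(1/2)`
  set S : Set (ℝ × EuclideanSpace ℝ (Fin 3)) :=
    parabolicCylinder (1 / 2) ((0 : ℝ), (0 : EuclideanSpace ℝ (Fin 3))) with hS
  have hSo : IsOpen S := isOpen_parabolicCylinder _ _
  have hVH' : HolderOnWith K α V S := hVH
  have hVae' : V =ᵐ[volume.restrict S] uncurry U := hVae
  have h12 : S ⊆ parabolicCylinder (3 / 4) (0 : ℝ × EuclideanSpace ℝ (Fin 3)) :=
    parabolicCylinder_zero_mono (by norm_num) (by norm_num)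
  have hVb : ∀ z ∈ S, ‖V z‖ ≤ 1 := by
    refine norm_le_of_ae_norm_le_of_continuousOn' (μ := volume) hSo (hVH'.continuousOn hα) ?_
    filter_upwards [hVae', ae_restrict_of_ae_restrict_of_subset h12 hbd] with z hz hb
    rw [hz]
    exact hb
  obtain ⟨hWH, hWF⟩ := holderOnWith_extendFrom_closure hVH' hα
  refine ⟨extendFrom S V, K, α, hα, hWH, ?_, ?_⟩
  · filter_upwards [hVae', ae_restrict_mem hSo.measurableSet] with z hz hzS
    rw [hWF hzS, hz]
  · intro z hz
    exact (norm_extendFrom_le_of_holderOnWith hVH' hα hVb hz).trans_lt one_lt_two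

/-- **ESS Lemma 2.2 (`k = 1`) over the mis-parenthesised class, proved** — discharge of the
named fact `ess_epsilon_regularity` (the accepted reduction `ess_epsilon_regularity_of'` of
`NSSuitableESSProofs.lean` fed with `ess_epsilon_regularity'_holds`).
[cite: EscauriazaSereginSverak2003, Lemma 2.2 (k = 1) with Remark 2.3] -/
theorem ess_epsilon_regularity_holds : ess_epsilon_regularity :=
  ess_epsilon_regularity_of' ess_epsilon_regularity'_holds

end Literature.Analysis.FluidPDE

end
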